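import Summits.BirchSwinnertonDyer.BirchSwinnertonDyer.Theorems.ThetaPartnerAtTwoSignedControlAtTwoPlusKimLiftTop
import Summits.BirchSwinnertonDyer.BirchSwinnertonDyer.Theorems.ThetaPartnerAtTwoSignedControlAtTwoSignedCasselsCount
import Summits.BirchSwinnertonDyer.BirchSwinnertonDyer.Theorems.ByReductionTypeAtTwoSupersingularFlatCountTwoOfH1Sigma
import Summits.BirchSwinnertonDyer.BirchSwinnertonDyer.Theorems.ByReductionTypeAtTwoSupersingularFlatLocalLiftAway
import Literature.NumberTheory.EllipticCurves.Greenberg1999.LocalQuotientControlSurjective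
import Literature.NumberTheory.EllipticCurves.Greenberg1999.H1SigmaInftyRankOne
import Literature.NumberTheory.EllipticCurves.H1SigmaDualFiniteProofs
import HarnessLib

/-!
# COINV⁺@2 and KIM⁺@2 FROM PRINT BY NAME, modulo the single `±`-local lift at the place above `2`:
# `(Sel^ε(E/ℚ_∞))_γ = 0` and «`X^ε` has no nonzero finite `Λ`-submodule» from Greenberg's Prop. 4.13 (Cassels),
# Prop. 4.12, pp. 119–120 (corank count), p. 108 (local surjectivity at `v ∤ p`) and §5 p. 140 / Kato Thm. 12.4
# (`Λ`-corank 1), all cited as Literature facts, plus the kernel of parts 1–3 — and EC2 re-derived on this road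

Route `ThetaPartnerAtTwo` (TP2; crux shared with `ResidualThetaTransportAtTwo`), crux K4 `SignedControlAtTwo`
(stmt-BirchSwinnertonDyer-20309), line `eulerchar` v4 (skeleton sha16 1933daf127d03c20), stub
`stub_plusKimNoFiniteSubmoduleTwo` (KIM⁺@2). Seat `prover-bsd-wall-tp2-p3-w2` (width seat 2/3). Part 4 of the KIM⁺
series — THE DOOR (the `±` twin of the ♭ road's parts 9/12/14/15, `bsd-2adic-ss-1` GEN 12–13, whose generic
theorems `SSFlatEC.coinvariantsRank_eq_zpCorank_unramifiedOutside_top`, `SSFlatEC.exists_localLift_of_localSurj`,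
`IwasawaAlgebra.finite_invariants_of_rank_eq_one_of_coinvariantsRank_le_one` and the tree theorem
`Greenberg1999.finite_dual_H1Sigma_holds` are cited by name).

THE DOOR `signedEndCoinvariants_subsingleton_two_of_print`. `W/ℚ` elliptic, globally minimal, good supersingular at
`2`; `κ` the cyclotomic `ℤ₂`-extension with topological generator `γ`; a sign `ε`; `Σ₀` a finite set of places with
good reduction off `Σ₀ ∪ {2}`. Assume
* PRINT BY NAME: `Greenberg1999.casselsSurjectivity_H1Sigma ℚ` (Prop. 4.13 / p. 122, Cassels),
  `Greenberg1999.prop412_noFiniteSubmodule_H1Sigma_of_rank_one` (Prop. 4.12), `Greenberg1999.h1Sigma_zpCorank_le_degree ℚ`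
  (pp. 119–120), `Greenberg1999.localQuotient_restriction_surjective ℚ` (p. 108), `Greenberg1999.h1SigmaInfty_rank_eq_one`
  (§5 p. 140 / Kato Astérisque 295 Thm. 12.4);
* (LOC^ε@2), displayed — the honest READ-AT-2 residue: for every `t ∈ H¹(ℚ_Σ/ℚ_∞, E[2^∞])` which is
  `Γ_ℚ`-invariant modulo `Sel^ε_∞`, at the place(s) `w ∋ 2` a `2`-power-torsion local class `x_w ∈ H¹(Γ_{ℚ₂}, E)`
  with «`loc_w y = x_w` ⇒ `t − res y` classically Kummer over `ℚ_∞` above `w` AND `t − res y = h_n d` for a layer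
  class `d` in Kobayashi's signed Kummer condition `𝒦^ε_n(w)`» — in print this is the surjectivity
  `H¹(ℚ₂, E)[2^∞] ↠ (H¹(ℚ_{∞,w}, E[2^∞])/E^ε(ℚ_{∞,w}) ⊗ ℚ₂/ℤ₂)^Γ`, i.e. `(E^ε(ℚ_{∞,w}) ⊗ ℚ₂/ℤ₂)_Γ = 0`
  (B. D. Kim 2013 Props. 2.2–2.3 / proof of Cor. 3.15 at ODD `p`: `(E^±(k_∞) ⊗ ℚ_p/ℤ_p)^∨ ≅ Λ`; Kitajima–Otsuki
  2018 Prop. 1.5; NOT in print at `p = 2`);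
* `Sel_{2^∞}(E/ℚ)` finite.
Then `(Sel^ε(E/ℚ_∞))_γ = 0` (COINV^ε@2), hence (§2) every Pontryagin-dual datum `D` of `Sel^ε(E/ℚ_∞)` has no nonzero
finite `Λ`-submodule (KIM^ε@2 — the conclusion of the registered stub, for the curve and datum at hand), and (§3)
the line's theorem EC2 (`signedEulerCharTwo`, v1's load-bearing stub verbatim) follows from INJ⁺@2 + the five
PRINT facts + LOC⁺@2 through the landed `SignedEC.signedEulerChar_two_of_localInj_of_cassels_of_coinv`.
HONEST TAG of K4 after this file: PUB-by-name {Prop. 4.13, Prop. 4.12, pp. 119–120, p. 108, p. 140/Kato 12.4}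
∘ THEOREM (KIM⁺ parts 1–4, SignedEC files of the lead) ∘ displayed {INJ⁺@2, LOC⁺@2} — the `±` local theory at `2`
of ONE formal group over ONE tower, nothing else. The registered stub's torsion-only form (no `Sel_{2^∞}(E/ℚ)`-
finiteness) is NOT reached on this road (Greenberg's twist `A_s`, Prop. 4.14, would be needed); the line consumes
KIM⁺ only under `Finite (Sel_{2^∞}(E/ℚ))` (theorem `signedEulerCharTwo`), which §3 serves. Nothing about any curve
is asserted; closes no item by itself; BSD is not proved by any of this.

References: [GreenbergLNM1716] §4 Prop. 4.12, Prop. 4.13 / p. 122, pp. 104, 107–108, 119–120, §5 p. 140;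
[Kato2004Asterisque] Thm. 12.4; [BDKim2013] Thm. 1.1, Props. 2.2–2.3, Thm. 3.14, Cor. 3.15; [KitajimaOtsuki2018]
Prop. 1.5, Thm. 1.3; [Kobayashi2003] Def. 1.1; [Cassels1964ArithmeticVII].
-/

set_option autoImplicit false
-- the Theorems namespace of this sub repeats the summit name by design (D-0017 nested layout)
set_option linter.dupNamespace false

noncomputable section

open scoped Classical NumberField

open NumberField IsDedekindDomain

namespace Summit.BirchSwinnertonDyer.BirchSwinnertonDyer.Theorems.SignedEC

open Literature.NumberTheory.EllipticCurves Literature.NumberTheory.GaloisRepresentations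
  WeierstrassCurve ZpExtension Literature.NumberTheory.EllipticCurves.Kobayashi2003
  Literature.NumberTheory.EllipticCurves.IwasawaDual Literature.NumberTheory.EllipticCurves.IwasawaAlgebra
  Literature.NumberTheory.EllipticCurves.GreenbergVatsal2000 Literature.NumberTheory.EllipticCurves.Rank1Residual

variable (W : WeierstrassCurve ℚ) [W.IsElliptic] [W.IsGloballyMinimal] (κ : ZpExtension ℚ 2) (ε : ℤˣ)

/-! ## §1 THE DOOR: COINV^ε@2 from PRINT by name + LOC^ε@2 -/

/-- **THE DOOR: `(Sel^ε(E/ℚ_∞))_γ = 0` from Greenberg's Prop. 4.13 (Cassels), Prop. 4.12, pp. 119–120, p. 108 and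
p. 140 / Kato Thm. 12.4 BY NAME, plus kernel, modulo the single `±`-local lift at the place above `2`.** `W/ℚ`
elliptic, globally minimal, good supersingular at `2` (so `E(ℚ)[2] = 0`: `#E(ℚ)[2^∞] = 1` for Cassels and the
restriction maps `h_n` injective); `κ` cyclotomic with topological generator `γ`; sign `ε`; `Σ₀` finite with good
reduction off `Σ₀ ∪ {2}`. The dual datum `Y` of `H = H¹(ℚ_Σ/ℚ_∞, E[2^∞])` is SUPPLIED (`finite_dual_H1Sigma_holds`), its
`Λ`-rank `1` is `h1SigmaInfty_rank_eq_one`, (a) is Prop. 4.12, (b) `Y[T]` finite is pp. 119–120's corank count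
(`h1Sigma_zpCorank_le_degree` + `coinvariantsRank_eq_zpCorank_unramifiedOutside_top` + the `Λ`-lemma), CASSELS is
Prop. 4.13, LOC at `w ∤ 2` is p. 108 (`localQuotient_restriction_surjective`) through `exists_localLift_of_localSurj`;
the chase is part 3. [cite: GreenbergLNM1716, §4 Prop. 4.13 / p. 122, Prop. 4.12, pp. 104, 107–108, 119–120, §5 p. 140]
[cite: Kato2004Asterisque, Thm. 12.4] [cite: BDKim2013, Thm. 3.14 and proof of Cor. 3.15] -/
theorem signedEndCoinvariants_subsingleton_two_of_print (hss : GoodSS W 2) (hκ : κ.IsCyclotomic)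
    {γ : Field.absoluteGaloisGroup ℚ} (hγ : κ.IsTopGenerator γ)
    (S₀ : Finset (HeightOneSpectrum (𝓞 ℚ)))
    (hgood : ∀ w : HeightOneSpectrum (𝓞 ℚ), w ∉ S₀ → ((2 : ℕ) : 𝓞 ℚ) ∉ w.asIdeal → W.HasGoodReductionAt w)
    -- PRINT BY NAME
    (hC : Greenberg1999.casselsSurjectivity_H1Sigma ℚ)
    (h412 : Greenberg1999.prop412_noFiniteSubmodule_H1Sigma_of_rank_one)
    (hcork : Greenberg1999.h1Sigma_zpCorank_le_degree ℚ)
    (hP108 : Greenberg1999.localQuotient_restriction_surjective ℚ)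
    (hWL : Greenberg1999.h1SigmaInfty_rank_eq_one)
    -- (LOC^ε@2): the single-place local lift at the place(s) above `2`, with Kobayashi's signed clause
    (hloc2 : ∀ t ∈ unramifiedOutside κ.kerSubgroup (W.geomPrimaryTorsion 2) 2
        (↑S₀ : Set (HeightOneSpectrum (𝓞 ℚ))),
      (∀ σ : Field.absoluteGaloisGroup ℚ, W.conjH1 2 κ.kerSubgroup σ t - t ∈ signedSelmerInfty W κ ε) →
      ∀ w : HeightOneSpectrum (𝓞 ℚ), ((2 : ℕ) : 𝓞 ℚ) ∈ w.asIdeal →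
      ∃ xw : discreteH1 (localSubgroup (⊤ : Subgroup (Field.absoluteGaloisGroup ℚ)) (w.adicCompletion ℚ))
          (localPoints W (w.adicCompletion ℚ)),
        (∃ k : ℕ, 2 ^ k • xw = 0) ∧
        ∀ y : W.subgroupH1 2 (⊤ : Subgroup (Field.absoluteGaloisGroup ℚ)),
          W.localResOver 2 ⊤ (w.adicCompletion ℚ) y = xw →
          t - W.resOfLe 2 (le_top : κ.kerSubgroup ≤ ⊤) y ∈ W.localKerOver 2 κ.kerSubgroup (w.adicCompletion ℚ) ∧
          ∃ (n : ℕ) (d : W.subgroupH1 2 (κ.layerSubgroup n)),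
            d ∈ localKummerOverOfEmb W 2 (κ.layerSubgroup n) (closureEmb (K := ℚ) (w.adicCompletion ℚ))
              (signedLocalPoints κ (w.adicCompletion ℚ) W ε n) ∧
            W.layerToInfty κ n d = t - W.resOfLe 2 (le_top : κ.kerSubgroup ≤ ⊤) y)
    (hSel : Finite (W.selmerGroupPInfty 2)) :
    Subsingleton (EndCoinvariants (conjSignedSelmerInfty W κ ε γ - 1)) := by
  have hgood' : ∀ w : HeightOneSpectrum (𝓞 ℚ), w ∉ (↑S₀ : Set (HeightOneSpectrum (𝓞 ℚ))) →
      ((2 : ℕ) : 𝓞 ℚ) ∉ w.asIdeal → W.HasGoodReductionAt w :=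
    fun w hw hpw ↦ hgood w (fun h ↦ hw (Finset.mem_coe.mpr h)) hpw
  -- `E(ℚ)[2] = 0` at good supersingular `2`: `#E(ℚ)[2^∞] = 1` and the `h_n` injective
  have hirr := (Summit.BirchSwinnertonDyer.Rank1Residual.X5.O1.irr_two_iff_forall_two_nsmul W).mp
    (Summit.BirchSwinnertonDyer.Rank1Residual.P2.irr_two_of_goodSS_two W hss)
  have hE : Nat.card (MulAction.fixedPoints (Field.absoluteGaloisGroup ℚ) (W.geomPrimaryTorsion 2)) = 1 := by
    refine W.natCard_fixedPoints_absoluteGaloisGroup_geomPrimaryTorsion_eq_one (p := 2) fun P hP ↦ ?_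
    apply hirr P
    convert hP
  have hinjh : ∀ m, Function.Injective (W.layerToInfty κ m) := fun m ↦ by
    refine Summit.BirchSwinnertonDyer.Rank1Residual.Additive.layerToInfty_injective_of_no_pTorsion W κ
      (fun P hP ↦ ?_) m
    apply hirr P
    convert hP
  -- the dual datum of `H¹(ℚ_Σ/ℚ_∞, E[2^∞])`: a finitely generated one EXISTS (tree theorem)
  obtain ⟨Y, _instY₁, _instY₂, _instY₃, dY, hbij, hT, hCY⟩ :=
    Greenberg1999.finite_dual_H1Sigma_holds W 2 κ γ hκ hγ S₀ hgood
  -- (b₁) its `Λ`-rank is `1`: PRINT BY NAME (Greenberg p. 140 / Kato Thm. 12.4)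
  have hrank : Module.rank (IwasawaAlgebra 2) Y = 1 := hWL W 2 κ γ hκ hγ S₀ hgood Y dY hbij hT hCY
  -- (a) no nonzero finite `Λ`-submodule: Prop. 4.12 BY NAME
  have hY : ∀ N : Submodule (IwasawaAlgebra 2) Y, Finite N → N = ⊥ :=
    h412 W 2 κ γ hκ hγ S₀ hgood Y dY hbij hT hCY hrank
  -- (b₂) `Y[T]` finite: `rank_{ℤ₂} Y/TY = corank_{ℤ₂} H¹(ℚ_Σ/ℚ, E[2^∞]) ≤ [ℚ:ℚ] = 1` (pp. 119–120 BY NAME)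
  have hco : coinvariantsRank 2 Y ≤ 1 := by
    rw [SSFlatEC.coinvariantsRank_eq_zpCorank_unramifiedOutside_top W κ hγ S₀.finite_toSet dY hbij hT hCY]
    have h := hcork W 2 hSel (↑S₀ : Set (HeightOneSpectrum (𝓞 ℚ))) S₀.finite_toSet hgood'
    rwa [Module.finrank_self] at h
  have hfin : Finite (invariants 2 Y) :=
    IwasawaAlgebra.finite_invariants_of_rank_eq_one_of_coinvariantsRank_le_one 2 hrank hco
  -- `Sel^ε_∞ ≤ Sel_∞ ≤ 𝒦_w` at every finite `w`
  have hSelle : ∀ w : HeightOneSpectrum (𝓞 ℚ),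
      signedSelmerInfty W κ ε ≤ W.localKerOver 2 κ.kerSubgroup (w.adicCompletion ℚ) := fun w s hs ↦ by
    have h1 := ((W.mem_selmerGroupOver_iff 2 κ.kerSubgroup s).1 (signedSelmerInfty_le_selmerInfty W κ ε hs)).1 w 1
    rwa [W.conjH1_one_holds 2 κ.kerSubgroup, AddMonoidHom.id_apply] at h1
  -- the chase of part 3: CASSELS by name, LOC at `w ∤ 2` by p. 108, LOC^ε at `w ∋ 2` displayed
  refine signedEndCoinvariants_subsingleton_of_cassels_top W κ ε hκ hinjh hγ (↑S₀ : Set (HeightOneSpectrum (𝓞 ℚ)))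
    hgood' dY hbij hT hCY hY hfin
    (fun x xi hx hxi ↦ hC W 2 hSel hE (↑S₀) S₀.finite_toSet hgood' x xi hx hxi) (fun t ht hconj w _ ↦ ?_)
  by_cases h2 : ((2 : ℕ) : 𝓞 ℚ) ∈ w.asIdeal
  · obtain ⟨xw, hx, hmain⟩ := hloc2 t ht hconj w h2
    exact ⟨xw, hx, fun y hy ↦ ⟨(hmain y hy).1, fun _ ↦ (hmain y hy).2⟩⟩
  · -- `w ∤ 2`: Greenberg p. 108 by name, through the ♭ road's part 13; the signed clause is vacuous
    obtain ⟨xw, hx, hmain⟩ :=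
      SSFlatEC.exists_localLift_of_localSurj W κ (hP108 W 2 κ hκ w h2) _ (hSelle w) t hconj
    exact ⟨xw, hx, fun y hy ↦ ⟨hmain y hy, fun hw2 ↦ absurd (by exact_mod_cast hw2) h2⟩⟩

/-- **COINV^ε@2 in `Nat.card` form** (the shape of line `eulerchar` v3's `stub_plusCoinvTwo` and of the `hcoinv`
binder of the landed `signedEulerChar_two_of_localInj_of_cassels_of_coinv`): under the door's hypotheses,
`#(Sel^ε(E/ℚ_∞))_γ = 1`. [cite: GreenbergLNM1716, §4 p. 104, Prop. 4.12, Prop. 4.13, p. 119] -/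
theorem natCard_signedEndCoinvariants_two_eq_one_of_print (hss : GoodSS W 2) (hκ : κ.IsCyclotomic)
    {γ : Field.absoluteGaloisGroup ℚ} (hγ : κ.IsTopGenerator γ)
    (S₀ : Finset (HeightOneSpectrum (𝓞 ℚ)))
    (hgood : ∀ w : HeightOneSpectrum (𝓞 ℚ), w ∉ S₀ → ((2 : ℕ) : 𝓞 ℚ) ∉ w.asIdeal → W.HasGoodReductionAt w)
    (hC : Greenberg1999.casselsSurjectivity_H1Sigma ℚ)
    (h412 : Greenberg1999.prop412_noFiniteSubmodule_H1Sigma_of_rank_one)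
    (hcork : Greenberg1999.h1Sigma_zpCorank_le_degree ℚ)
    (hP108 : Greenberg1999.localQuotient_restriction_surjective ℚ)
    (hWL : Greenberg1999.h1SigmaInfty_rank_eq_one)
    (hloc2 : ∀ t ∈ unramifiedOutside κ.kerSubgroup (W.geomPrimaryTorsion 2) 2
        (↑S₀ : Set (HeightOneSpectrum (𝓞 ℚ))),
      (∀ σ : Field.absoluteGaloisGroup ℚ, W.conjH1 2 κ.kerSubgroup σ t - t ∈ signedSelmerInfty W κ ε) →
      ∀ w : HeightOneSpectrum (𝓞 ℚ), ((2 : ℕ) : 𝓞 ℚ) ∈ w.asIdeal →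
      ∃ xw : discreteH1 (localSubgroup (⊤ : Subgroup (Field.absoluteGaloisGroup ℚ)) (w.adicCompletion ℚ))
          (localPoints W (w.adicCompletion ℚ)),
        (∃ k : ℕ, 2 ^ k • xw = 0) ∧
        ∀ y : W.subgroupH1 2 (⊤ : Subgroup (Field.absoluteGaloisGroup ℚ)),
          W.localResOver 2 ⊤ (w.adicCompletion ℚ) y = xw →
          t - W.resOfLe 2 (le_top : κ.kerSubgroup ≤ ⊤) y ∈ W.localKerOver 2 κ.kerSubgroup (w.adicCompletion ℚ) ∧
          ∃ (n : ℕ) (d : W.subgroupH1 2 (κ.layerSubgroup n)),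
            d ∈ localKummerOverOfEmb W 2 (κ.layerSubgroup n) (closureEmb (K := ℚ) (w.adicCompletion ℚ))
              (signedLocalPoints κ (w.adicCompletion ℚ) W ε n) ∧
            W.layerToInfty κ n d = t - W.resOfLe 2 (le_top : κ.kerSubgroup ≤ ⊤) y)
    (hSel : Finite (W.selmerGroupPInfty 2)) :
    Nat.card (EndCoinvariants (conjSignedSelmerInfty W κ ε γ - 1)) = 1 := by
  haveI := signedEndCoinvariants_subsingleton_two_of_print W κ ε hss hκ hγ S₀ hgood hC h412 hcork hP108 hWL hloc2
    hSel
  exact Nat.card_unique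

/-! ## §2 KIM^ε@2: no nonzero finite `Λ`-submodule, for every Pontryagin-dual datum -/

/-- **B. D. Kim's Thm. 1.1 READ AT `2` on the PRINT + LOC road** — the conclusion of the registered stub
`stub_plusKimNoFiniteSubmoduleTwo` for the curve `W`, the cyclotomic datum `(κ, γ)` and EVERY Pontryagin-dual datum
`D` of `Sel^ε(E/ℚ_∞)` (its `Module.Finite` / `Module.IsTorsion` premises unused), under: the five PRINT facts by
name, LOC^ε@2, and `Sel_{2^∞}(E/ℚ)` finite. [cite: BDKim2013, Thm. 1.1 and Thm. 3.14]
[cite: GreenbergLNM1716, §4 Prop. 4.12, Prop. 4.13, pp. 107–108, 119–120, §5 p. 140] -/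
theorem signed_forall_noFiniteSubmodule_two_of_print (hss : GoodSS W 2) (hκ : κ.IsCyclotomic)
    {γ : Field.absoluteGaloisGroup ℚ} (hγ : κ.IsTopGenerator γ)
    (S₀ : Finset (HeightOneSpectrum (𝓞 ℚ)))
    (hgood : ∀ w : HeightOneSpectrum (𝓞 ℚ), w ∉ S₀ → ((2 : ℕ) : 𝓞 ℚ) ∉ w.asIdeal → W.HasGoodReductionAt w)
    (hC : Greenberg1999.casselsSurjectivity_H1Sigma ℚ)
    (h412 : Greenberg1999.prop412_noFiniteSubmodule_H1Sigma_of_rank_one)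
    (hcork : Greenberg1999.h1Sigma_zpCorank_le_degree ℚ)
    (hP108 : Greenberg1999.localQuotient_restriction_surjective ℚ)
    (hWL : Greenberg1999.h1SigmaInfty_rank_eq_one)
    (hloc2 : ∀ t ∈ unramifiedOutside κ.kerSubgroup (W.geomPrimaryTorsion 2) 2
        (↑S₀ : Set (HeightOneSpectrum (𝓞 ℚ))),
      (∀ σ : Field.absoluteGaloisGroup ℚ, W.conjH1 2 κ.kerSubgroup σ t - t ∈ signedSelmerInfty W κ ε) →
      ∀ w : HeightOneSpectrum (𝓞 ℚ), ((2 : ℕ) : 𝓞 ℚ) ∈ w.asIdeal →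
      ∃ xw : discreteH1 (localSubgroup (⊤ : Subgroup (Field.absoluteGaloisGroup ℚ)) (w.adicCompletion ℚ))
          (localPoints W (w.adicCompletion ℚ)),
        (∃ k : ℕ, 2 ^ k • xw = 0) ∧
        ∀ y : W.subgroupH1 2 (⊤ : Subgroup (Field.absoluteGaloisGroup ℚ)),
          W.localResOver 2 ⊤ (w.adicCompletion ℚ) y = xw →
          t - W.resOfLe 2 (le_top : κ.kerSubgroup ≤ ⊤) y ∈ W.localKerOver 2 κ.kerSubgroup (w.adicCompletion ℚ) ∧
          ∃ (n : ℕ) (d : W.subgroupH1 2 (κ.layerSubgroup n)),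
            d ∈ localKummerOverOfEmb W 2 (κ.layerSubgroup n) (closureEmb (K := ℚ) (w.adicCompletion ℚ))
              (signedLocalPoints κ (w.adicCompletion ℚ) W ε n) ∧
            W.layerToInfty κ n d = t - W.resOfLe 2 (le_top : κ.kerSubgroup ≤ ⊤) y)
    (hSel : Finite (W.selmerGroupPInfty 2)) :
    ∀ (D : SignedSelmerDualData W κ γ ε) [Module.Finite (IwasawaAlgebra 2) D.X],
      Module.IsTorsion (IwasawaAlgebra 2) D.X →
      ∀ N : Submodule (IwasawaAlgebra 2) D.X, Finite N → N = ⊥ := by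
  intro D _ _
  haveI := signedEndCoinvariants_subsingleton_two_of_print W κ ε hss hκ hγ S₀ hgood hC h412 hcork hP108 hWL hloc2
    hSel
  exact signed_forall_finite_eq_bot_of_endCoinvariants_subsingleton D hγ

/-! ## §3 EC2 (`signedEulerCharTwo`, v1's load-bearing stub verbatim) on this road: INJ⁺@2 + PRINT + LOC⁺@2 -/

/-- **The line's theorem EC2 — B. D. Kim's signed `Γ`-Euler characteristic READ AT `2` on Kobayashi's `Sel⁺`,
verbatim the skeleton's `signedEulerCharTwo` body for `W`, `κ`, `γ` — from INJ⁺@2, the five PRINT facts by name and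
LOC⁺@2** (with `Σ₀` any finite set of places carrying the bad reduction prime to `2`): CASSELS' count is the lead's
`signedCasselsCountTwo_of_localInj_of_casselsSurjectivity` (Prop. 4.13 by name + INJ⁺@2), COINV⁺@2 is §1, and the
assembly is the landed `signedEulerChar_two_of_localInj_of_cassels_of_coinv`. So on line `eulerchar` the crux K4
reads: PUB {Prop. 4.13, Prop. 4.12, pp. 119–120, p. 108, p. 140 / Kato 12.4} ∘ THEOREM ∘ {INJ⁺@2, LOC⁺@2}.
[cite: BDKim2013, Cor. 3.15] [cite: GreenbergLNM1716, §4 pp. 102–109, Prop. 4.12, Prop. 4.13, pp. 119–122, §5 p. 140]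
[cite: Kato2004Asterisque, Thm. 12.4] -/
theorem signedEulerChar_two_of_localInj_of_print_of_loc2 (hss : GoodSS W 2) (hκ : κ.IsCyclotomic)
    {γ : Field.absoluteGaloisGroup ℚ} (hγ : κ.IsTopGenerator γ)
    (S₀ : Finset (HeightOneSpectrum (𝓞 ℚ)))
    (hgood : ∀ w : HeightOneSpectrum (𝓞 ℚ), w ∉ S₀ → ((2 : ℕ) : 𝓞 ℚ) ∉ w.asIdeal → W.HasGoodReductionAt w)
    -- INJ⁺@2
    (hinj : ∀ v : HeightOneSpectrum (𝓞 ℚ), (2 : 𝓞 ℚ) ∈ v.asIdeal →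
      ∀ y ∈ (signedSelmerInfty W κ 1).comap (W.layerToInfty κ 0),
        W.localResOver 2 (κ.layerSubgroup 0) (v.adicCompletion ℚ) y = 0)
    -- PRINT BY NAME
    (hC : Greenberg1999.casselsSurjectivity_H1Sigma ℚ)
    (h412 : Greenberg1999.prop412_noFiniteSubmodule_H1Sigma_of_rank_one)
    (hcork : Greenberg1999.h1Sigma_zpCorank_le_degree ℚ)
    (hP108 : Greenberg1999.localQuotient_restriction_surjective ℚ)
    (hWL : Greenberg1999.h1SigmaInfty_rank_eq_one)
    -- LOC⁺@2
    (hloc2 : ∀ t ∈ unramifiedOutside κ.kerSubgroup (W.geomPrimaryTorsion 2) 2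
        (↑S₀ : Set (HeightOneSpectrum (𝓞 ℚ))),
      (∀ σ : Field.absoluteGaloisGroup ℚ, W.conjH1 2 κ.kerSubgroup σ t - t ∈ signedSelmerInfty W κ 1) →
      ∀ w : HeightOneSpectrum (𝓞 ℚ), ((2 : ℕ) : 𝓞 ℚ) ∈ w.asIdeal →
      ∃ xw : discreteH1 (localSubgroup (⊤ : Subgroup (Field.absoluteGaloisGroup ℚ)) (w.adicCompletion ℚ))
          (localPoints W (w.adicCompletion ℚ)),
        (∃ k : ℕ, 2 ^ k • xw = 0) ∧
        ∀ y : W.subgroupH1 2 (⊤ : Subgroup (Field.absoluteGaloisGroup ℚ)),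
          W.localResOver 2 ⊤ (w.adicCompletion ℚ) y = xw →
          t - W.resOfLe 2 (le_top : κ.kerSubgroup ≤ ⊤) y ∈ W.localKerOver 2 κ.kerSubgroup (w.adicCompletion ℚ) ∧
          ∃ (n : ℕ) (d : W.subgroupH1 2 (κ.layerSubgroup n)),
            d ∈ localKummerOverOfEmb W 2 (κ.layerSubgroup n) (closureEmb (K := ℚ) (w.adicCompletion ℚ))
              (signedLocalPoints κ (w.adicCompletion ℚ) W 1 n) ∧
            W.layerToInfty κ n d = t - W.resOfLe 2 (le_top : κ.kerSubgroup ≤ ⊤) y)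
    (hSel : Finite (W.selmerGroupPInfty 2)) :
    Finite (endInvariants (conjSignedSelmerInfty W κ 1 γ - 1)) ∧
      ∃ u : ℤ_[2]ˣ, (Nat.card (endInvariants (conjSignedSelmerInfty W κ 1 γ - 1)) : ℚ_[2]) =
        ((u : ℤ_[2]) : ℚ_[2]) * ((2 : ℕ) : ℚ_[2]) ^ (padicValNat 2 W.tamagawaProduct) *
          (Nat.card (W.selmerGroupPInfty 2) : ℚ_[2]) *
            (Nat.card (EndCoinvariants (conjSignedSelmerInfty W κ 1 γ - 1)) : ℚ_[2]) :=
  signedEulerChar_two_of_localInj_of_cassels_of_coinv W hss κ hγ hinj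
    (signedCasselsCountTwo_of_localInj_of_casselsSurjectivity W hC hss hκ hinj)
    (fun hSel' _ ↦ natCard_signedEndCoinvariants_two_eq_one_of_print W κ 1 hss hκ hγ S₀ hgood hC h412 hcork hP108
      hWL hloc2 hSel') hSel

end Summit.BirchSwinnertonDyer.BirchSwinnertonDyer.Theorems.SignedEC

end
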